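import Summits.AtomisticToContinuum.FouriersLaw.Theorems.HeatModeWeylLawSpecificHeatLimitPathIntegral
import Literature.MathematicalPhysics.KineticTheory.LangevinChainGibbs
import Literature.Probability.Distributions.GaussianPiDensity
import HarnessLib

/-!
# The configurational Gibbs integrals of a nearest-neighbour chain in transfer-operator form

Helper file for item `stmt-AtomisticToContinuum-12398` (`SpecificHeatLimit`, route `HeatModeWeylLaw`
of `AtomisticToContinuum/FouriersLaw`). For an `OscillatorChain P` (pinning `U`, coupling `V`) at
temperature `T ≠ 0` write `a(q) = e^{-U(q)/4T}`, `ρ(dq) = a(q)² dq`, `k(q, q') = a(q) e^{-V(q'-q)/T} a(q')`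
(the symmetrised transfer kernel on `L²(ρ)`) and `h(q, q') = (U(q) + U(q'))/2 + V(q' - q)` (the
symmetrised bond energy). This file PROVES, for the `(n+1)`-site chain (`n` bonds):

* `sum_sum_ite_succ`, `potential_succ_eq`, `potential_succ_eq_bondSum` — the potential energy
  `Φ_{n+1}` of `LangevinChainGibbs.lean` (a double sum with `if j = i + 1`) as a sum over the `n`
  bonds: `Φ_{n+1}(q) = ∑_{i<n} h(qᵢ, qᵢ₊₁) + (U(q₀) + U(qₙ))/2`;
* `exp_neg_potential_succ_div` — the factorisation of the Boltzmann weight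
  `e^{-Φ_{n+1}/T} = a(q₀) (∏_{i<n} k(qᵢ, qᵢ₊₁)) a(qₙ) · ∏ᵢ a(qᵢ)²`;
* `integral_mul_exp_neg_potential_eq` — Lebesgue integrals against `e^{-Φ/T} dq` are
  `ρ^{⊗(n+1)}`-integrals against the path weight (`pi_withDensity_eq_withDensity_prod`);
* `integral_insertions_eq_inner` (**main**) — with bond insertions `m i`:
  `∫ f(q₀) (∏_{i<n} m i (qᵢ, qᵢ₊₁)) g(qₙ) e^{-Φ_{n+1}(q)/T} dq = ⟪[f a], ((List.range n).map Op).prod [g a]⟫`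
  for the `L²(ρ)` realisations `Op i` of the kernels `k · m i` (tree
  `integral_path_eq_inner_listProd`).

All [folklore]; no definitions (the functions `a, k, h` enter through defining hypotheses).
-/

noncomputable section

open MeasureTheory Set Filter Function
open scoped RealInnerProductSpace ENNReal

namespace Summit.AtomisticToContinuum.FouriersLaw.Theorems.SpecificHeatLimit

open Literature.MathematicalPhysics.KineticTheory.HeatConduction Literature.Analysis.OperatorTheory
open Literature.Probability.Distributions

variable (P : OscillatorChain)

/-! ### The potential energy as a sum over bonds -/

/-- The nearest-neighbour double sum `∑ᵢ ∑ⱼ [j = i + 1] F i j` over `Fin (n+1)` is the sum over the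
`n` bonds `(i, i+1)`. [folklore] -/
theorem sum_sum_ite_succ {n : ℕ} (F : Fin (n + 1) → Fin (n + 1) → ℝ) :
    (∑ i : Fin (n + 1), ∑ j : Fin (n + 1), if j.val = i.val + 1 then F i j else 0) =
      ∑ i : Fin n, F (Fin.castSucc i) i.succ := by
  rw [Fin.sum_univ_castSucc]
  have hlast : (∑ j : Fin (n + 1), if j.val = (Fin.last n).val + 1 then F (Fin.last n) j else 0) = 0 := by
    refine Finset.sum_eq_zero fun j _ => ?_
    rw [if_neg]
    rw [Fin.val_last]
    have := j.isLt
    omega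
  rw [hlast, add_zero]
  refine Finset.sum_congr rfl fun i _ => ?_
  rw [Finset.sum_eq_single i.succ]
  · rw [if_pos]
    simp [Fin.val_succ]
  · intro j _ hj
    rw [if_neg]
    intro h
    apply hj
    ext
    rw [h, Fin.val_succ, Fin.val_castSucc]
  · intro h
    exact absurd (Finset.mem_univ _) h

/-- `Φ_{n+1}(q) = ∑ᵢ U(qᵢ) + ∑_{i<n} V(qᵢ₊₁ - qᵢ)`. [folklore] -/
theorem potential_succ_eq (n : ℕ) (q : Fin (n + 1) → ℝ) :
    P.potential (n + 1) q =
      (∑ i : Fin (n + 1), P.U (q i)) + ∑ i : Fin n, P.V (q i.succ - q (Fin.castSucc i)) := by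
  unfold OscillatorChain.potential
  rw [sum_sum_ite_succ]

/-- **The potential energy as a sum of symmetrised bond energies plus a boundary term**:
`Φ_{n+1}(q) = ∑_{i<n} h(qᵢ, qᵢ₊₁) + (U(q₀) + U(qₙ))/2`, `h(q, q') = (U(q) + U(q'))/2 + V(q' - q)`.
[folklore] -/
theorem potential_succ_eq_bondSum (n : ℕ) (q : Fin (n + 1) → ℝ) {h : ℝ → ℝ → ℝ}
    (hh : ∀ x y, h x y = (P.U x + P.U y) / 2 + P.V (y - x)) :
    P.potential (n + 1) q =
      (∑ i : Fin n, h (q (Fin.castSucc i)) (q i.succ)) + (P.U (q 0) + P.U (q (Fin.last n))) / 2 := by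
  rw [potential_succ_eq]
  have h1 : ∑ i : Fin (n + 1), P.U (q i) = P.U (q 0) + ∑ i : Fin n, P.U (q i.succ) :=
    Fin.sum_univ_succ _
  have h2 : ∑ i : Fin (n + 1), P.U (q i) = (∑ i : Fin n, P.U (q (Fin.castSucc i))) + P.U (q (Fin.last n)) :=
    Fin.sum_univ_castSucc _
  have h3 : ∑ i : Fin n, ((P.U (q (Fin.castSucc i)) + P.U (q i.succ)) / 2) =
      ((∑ i : Fin n, P.U (q (Fin.castSucc i))) + ∑ i : Fin n, P.U (q i.succ)) / 2 := by
    rw [← Finset.sum_div, Finset.sum_add_distrib]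
  simp_rw [hh]
  rw [Finset.sum_add_distrib, h3]
  linarith

/-! ### Factorisation of the Boltzmann weight -/

/-- **Factorisation of the configurational Boltzmann weight along the transfer structure**: with
`a = e^{-U/4T}` and `k(q, q') = a(q) e^{-V(q'-q)/T} a(q')`,
`e^{-Φ_{n+1}(q)/T} = a(q₀) (∏_{i<n} k(qᵢ, qᵢ₊₁)) a(qₙ) · ∏ᵢ a(qᵢ)²` (`T ≠ 0`). [folklore] -/
theorem exp_neg_potential_succ_div (n : ℕ) {T : ℝ} (hT : T ≠ 0) {a : ℝ → ℝ}
    (ha : ∀ x, a x = Real.exp (-P.U x / (4 * T))) {k : ℝ → ℝ → ℝ}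
    (hk : ∀ x y, k x y = a x * Real.exp (-P.V (y - x) / T) * a y) (q : Fin (n + 1) → ℝ) :
    Real.exp (-P.potential (n + 1) q / T) =
      a (q 0) * (∏ i : Fin n, k (q (Fin.castSucc i)) (q i.succ)) * a (q (Fin.last n)) *
        ∏ i : Fin (n + 1), a (q i) ^ 2 := by
  -- left-hand side: `∏ a⁴ · ∏ κ`
  have ha4 : ∀ x, Real.exp (-P.U x / T) = a x ^ 4 := by
    intro x
    rw [ha, ← Real.exp_nat_mul]
    congr 1
    push_cast
    field_simp
  have hL : Real.exp (-P.potential (n + 1) q / T) =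
      (∏ i : Fin (n + 1), a (q i) ^ 4) * ∏ i : Fin n, Real.exp (-P.V (q i.succ - q (Fin.castSucc i)) / T) := by
    rw [potential_succ_eq, neg_add, add_div, Real.exp_add, neg_div, neg_div, Finset.sum_div,
      Finset.sum_div, ← Finset.sum_neg_distrib, ← Finset.sum_neg_distrib, Real.exp_sum, Real.exp_sum]
    congr 1
    · exact Finset.prod_congr rfl fun i _ => by rw [← neg_div, ha4]
    · exact Finset.prod_congr rfl fun i _ => by rw [← neg_div]
  -- right-hand side
  have h1 : a (q 0) * ∏ i : Fin n, a (q i.succ) = ∏ i : Fin (n + 1), a (q i) :=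
    (Fin.prod_univ_succ (fun i => a (q i))).symm
  have h2 : (∏ i : Fin n, a (q (Fin.castSucc i))) * a (q (Fin.last n)) = ∏ i : Fin (n + 1), a (q i) :=
    (Fin.prod_univ_castSucc (fun i => a (q i))).symm
  have h3 : (∏ i : Fin (n + 1), a (q i)) * (∏ i : Fin (n + 1), a (q i)) * ∏ i : Fin (n + 1), a (q i) ^ 2 =
      ∏ i : Fin (n + 1), a (q i) ^ 4 := by
    rw [← Finset.prod_mul_distrib, ← Finset.prod_mul_distrib]
    exact Finset.prod_congr rfl fun i _ => by ring
  rw [hL]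
  simp_rw [hk]
  rw [Finset.prod_mul_distrib, Finset.prod_mul_distrib]
  calc (∏ i : Fin (n + 1), a (q i) ^ 4) * ∏ i : Fin n, Real.exp (-P.V (q i.succ - q (Fin.castSucc i)) / T)
      = ((a (q 0) * ∏ i : Fin n, a (q i.succ)) * ((∏ i : Fin n, a (q (Fin.castSucc i))) * a (q (Fin.last n))) *
          ∏ i : Fin (n + 1), a (q i) ^ 2) * ∏ i : Fin n, Real.exp (-P.V (q i.succ - q (Fin.castSucc i)) / T) := by
        rw [h1, h2, h3]
    _ = _ := by ring

/-! ### From Lebesgue integrals to path integrals over `ρ = a² dq` -/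

/-- **Change of measure.** With `ρ(dq) = a(q)² dq`, for every `G`:
`∫ G(q) e^{-Φ_{n+1}(q)/T} dq = ∫ G(q) a(q₀) (∏_{i<n} k(qᵢ, qᵢ₊₁)) a(qₙ) dρ^{⊗(n+1)}(q)`. [folklore] -/
theorem integral_mul_exp_neg_potential_eq (n : ℕ) {T : ℝ} (hT : T ≠ 0) {a : ℝ → ℝ}
    (ha : ∀ x, a x = Real.exp (-P.U x / (4 * T))) (hUm : Measurable P.U) {k : ℝ → ℝ → ℝ}
    (hk : ∀ x y, k x y = a x * Real.exp (-P.V (y - x) / T) * a y) {ρ : Measure ℝ}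
    (hρ : ρ = volume.withDensity fun x => ENNReal.ofReal (a x ^ 2)) (G : (Fin (n + 1) → ℝ) → ℝ) :
    ∫ q : Fin (n + 1) → ℝ, G q * Real.exp (-P.potential (n + 1) q / T) =
      ∫ q : Fin (n + 1) → ℝ, G q * (a (q 0) * (∏ i : Fin n, k (q (Fin.castSucc i)) (q i.succ)) *
        a (q (Fin.last n))) ∂(Measure.pi fun _ => ρ) := by
  have ham : Measurable a := by
    have : a = fun x => Real.exp (-P.U x / (4 * T)) := funext ha
    rw [this]
    exact Real.measurable_exp.comp ((hUm.neg).div_const _)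
  have hpi : (Measure.pi fun _ : Fin (n + 1) => ρ) =
      (volume : Measure (Fin (n + 1) → ℝ)).withDensity
        fun q => ENNReal.ofReal (∏ i, a (q i) ^ 2) := by
    rw [hρ]
    exact pi_withDensity_eq_withDensity_prod (fun _ => fun x => a x ^ 2) (fun _ => ham.pow_const 2)
      (fun _ x => sq_nonneg _)
  have hDm : Measurable fun q : Fin (n + 1) → ℝ => ENNReal.ofReal (∏ i, a (q i) ^ 2) :=
    (Finset.measurable_prod _ fun i _ => (ham.comp (measurable_pi_apply i)).pow_const 2).ennreal_ofReal
  rw [hpi, integral_withDensity_eq_integral_toReal_smul hDm (Eventually.of_forall fun q => ENNReal.ofReal_lt_top)]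
  refine integral_congr_ae (Eventually.of_forall fun q => ?_)
  dsimp only
  rw [ENNReal.toReal_ofReal (Finset.prod_nonneg fun i _ => sq_nonneg _), smul_eq_mul,
    exp_neg_potential_succ_div P n hT ha hk q]
  ring

/-! ### The main identity: Gibbs integrals with bond insertions -/

/-- **Configurational Gibbs integrals with bond insertions in transfer-operator form.** Let `T ≠ 0`,
`a = e^{-U/4T}` (measurable `U`), `ρ = a² dq` finite, `k(q, q') = a(q) e^{-V(q'-q)/T} a(q')`, and let
`m i` (`i : ℕ`) be bond insertions such that the kernels `k · m i` are bounded and measurable with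
`L²(ρ)` realisations `Op i`. Then for `f, g` with `f a`, `g a` bounded measurable,
`∫ f(q₀) (∏_{i<n} m i (qᵢ, qᵢ₊₁)) g(qₙ) e^{-Φ_{n+1}(q)/T} dq = ⟪[f a], ((List.range n).map Op).prod [g a]⟫`.
[folklore] -/
theorem integral_insertions_eq_inner (n : ℕ) {T : ℝ} (hT : T ≠ 0) {a : ℝ → ℝ}
    (ha : ∀ x, a x = Real.exp (-P.U x / (4 * T))) (hUm : Measurable P.U) {k : ℝ → ℝ → ℝ}
    (hk : ∀ x y, k x y = a x * Real.exp (-P.V (y - x) / T) * a y) {ρ : Measure ℝ} [IsFiniteMeasure ρ]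
    (hρ : ρ = volume.withDensity fun x => ENNReal.ofReal (a x ^ 2))
    {m : ℕ → ℝ → ℝ → ℝ} {C : ℝ} (hKm : ∀ i, Measurable (uncurry fun x y => k x y * m i x y))
    (hKb : ∀ i x y, ‖k x y * m i x y‖ ≤ C) {Op : ℕ → (Lp ℝ 2 ρ →L[ℝ] Lp ℝ 2 ρ)}
    (hOp : ∀ i (ψ : Lp ℝ 2 ρ), (Op i ψ : ℝ → ℝ) =ᵐ[ρ] fun x => ∫ y, (k x y * m i x y) * ψ y ∂ρ)
    {f g : ℝ → ℝ} (hf : Measurable fun x => f x * a x) {Bf : ℝ} (hfb : ∀ x, ‖f x * a x‖ ≤ Bf)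
    (hg : Measurable fun x => g x * a x) {Bg : ℝ} (hgb : ∀ x, ‖g x * a x‖ ≤ Bg) :
    ∫ q : Fin (n + 1) → ℝ, f (q 0) * (∏ i : Fin n, m i (q (Fin.castSucc i)) (q i.succ)) *
        g (q (Fin.last n)) * Real.exp (-P.potential (n + 1) q / T) =
      ⟪(memLp_two_of_bound (μ := ρ) hf hfb).toLp _,
        ((List.range n).map Op).prod ((memLp_two_of_bound (μ := ρ) hg hgb).toLp _)⟫ := by
  rw [integral_mul_exp_neg_potential_eq P n hT ha hUm hk hρ]
  have e : ∀ q : Fin (n + 1) → ℝ,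
      f (q 0) * (∏ i : Fin n, m i (q (Fin.castSucc i)) (q i.succ)) * g (q (Fin.last n)) *
        (a (q 0) * (∏ i : Fin n, k (q (Fin.castSucc i)) (q i.succ)) * a (q (Fin.last n))) =
      (f (q 0) * a (q 0)) * (∏ i : Fin n, (k (q (Fin.castSucc i)) (q i.succ) *
        m i (q (Fin.castSucc i)) (q i.succ))) * (g (q (Fin.last n)) * a (q (Fin.last n))) := by
    intro q
    rw [Finset.prod_mul_distrib]
    ring
  simp_rw [e]
  exact integral_path_eq_inner_listProd (K := fun i x y => k x y * m i x y) hKm hKb hOp hf hfb hg hgb n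

end Summit.AtomisticToContinuum.FouriersLaw.Theorems.SpecificHeatLimit

end
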